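import Summits.HubbardSuperconductivity.HubbardSuperconductivity.Theorems.ChiralWindowCwKLChiralWindowReductionL2
import HarnessLib

/-!
# Route `ChiralWindow`, crux `CwThesis` (stmt-HubbardSuperconductivity-10438), line `SketchIdeator3` v6:
# the route's own crux `CwKLChiralWindow` implies the line's `U`-free certificate

The lead skeleton of the line (`Cruxes/CwThesis/Lines/SketchIdeator3.lean`, v6) derives the crux `ChiralWindow.CwThesis` from
`TorusCooperLog.KLCanonical` (stmt-2681) and ONE `U`-free Kohn–Luttinger certificate at one window doping (registered stub
`stub_klCertificate`; anchor `cwThesis_of_klCanonical_of_klCertificate`, file `ChiralWindowCwThesisUFreeAnchor.lean`). This file shows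
that the certificate is formally DOMINATED by the route's existing crux `ChiralWindow.CwKLChiralWindow` (stmt-1741): its conjunct
(i) — at the lower window edge `δ = a ∈ [3/10, 12/25)`, `B₁g` leads every other channel by `γU²` for all `U ∈ (0,U₁)` — evaluated
at a single coupling `U ∈ (0, min U₁ 1)` already gives both clauses of the `U`-free certificate with the same margin `γ`, because
off `A1g` the channel bottoms are exactly `U²`-homogeneous (`kl_rl_channelInf_sq_of_meanZero` on the `D₄`-invariant finite
Fermi-curve measure) and on a mean-zero `A1g` state the pairing form is `U²`-homogeneous too (`kl_rl_pairingForm_sq`) while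
`Λ_U(A1g)` sits below it (`kl_rl_bddBelow`). So the registered certificate stub adds no obligation beyond the route's items:
`stub_klCertificate ⇐ CwKLChiralWindow`, and numerically it is far weaker (one doping, no partner channel, no isolation clause,
no node covering). Main result: `klCertificate_of_cwKLChiralWindow` (registered on the crux). No definitions. [folklore]
-/

noncomputable section

-- the tree's namespace repeats the summit name by design (D-0017)
set_option linter.dupNamespace false

namespace Summit.HubbardSuperconductivity.HubbardSuperconductivity.Theorems.CwThesis

open MeasureTheory Real Set Filter
open Literature.MathematicalPhysics.QuantumLattice
open Summit.HubbardSuperconductivity.HubbardSuperconductivity.Theses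

/-- **`CwKLChiralWindow` implies the `U`-free certificate of line `SketchIdeator3`.** From conjunct (i) of
`ChiralWindow.CwKLChiralWindow` at `δ = a` and one coupling `U ∈ (0, min U₁ 1)`: for `χ ∉ {B1g, A1g}`,
`U²(Λ_1(B1g) + γ) = Λ_U(B1g) + γU² ≤ Λ_U(χ) = U² Λ_1(χ)`; for a mean-zero `A1g` channel state `φ`,
`U²(Λ_1(B1g) + γ) ≤ Λ_U(A1g) ≤ ⟨φ, Γ_U φ⟩ = U² ⟨φ, Γ_1 φ⟩`; divide by `U² > 0`. [folklore] -/
theorem klCertificate_of_cwKLChiralWindow (hW : ChiralWindow.CwKLChiralWindow) :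
    ∃ δ₀ ∈ Set.Icc (3/10 : ℝ) (12/25), ∃ γ : ℝ, 0 < γ ∧
      (∀ χ : D4Irrep, χ ≠ D4Irrep.B1g → χ ≠ D4Irrep.A1g →
        channelInf (squareDispersion 1 0) (chemicalPotentialOfDensity (squareDispersion 1 0) (1 - δ₀)) 1 D4Irrep.B1g + γ ≤
          channelInf (squareDispersion 1 0) (chemicalPotentialOfDensity (squareDispersion 1 0) (1 - δ₀)) 1 χ) ∧
      (∀ φ : Momentum → ℝ,
        IsChannelState (squareDispersion 1 0) (chemicalPotentialOfDensity (squareDispersion 1 0) (1 - δ₀)) D4Irrep.A1g φ →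
        ∫ k, φ k ∂fermiCurveMeasure (squareDispersion 1 0) (chemicalPotentialOfDensity (squareDispersion 1 0) (1 - δ₀)) = 0 →
          channelInf (squareDispersion 1 0) (chemicalPotentialOfDensity (squareDispersion 1 0) (1 - δ₀)) 1 D4Irrep.B1g + γ ≤
            pairingForm (squareDispersion 1 0) (chemicalPotentialOfDensity (squareDispersion 1 0) (1 - δ₀)) 1 φ) := by
  obtain ⟨χs, -, -, a, b, γ, c, U₁, ha, hab, hb, hγ, -, hU₁, hU⟩ := hW
  have haI : a ∈ Set.Icc (3/10 : ℝ) (12/25) := ⟨ha, by linarith⟩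
  set μ := chemicalPotentialOfDensity (squareDispersion 1 0) (1 - a) with hμdef
  have hμ : μ ∈ Set.Ioo (-4 : ℝ) 0 := stub_klMuWindow a haI
  -- one admissible coupling `U ∈ (0, U₁) ∩ (0, 1)`
  set U : ℝ := min (U₁ / 2) (1 / 2) with hUdef
  have hU0 : 0 < U := lt_min (by linarith) (by norm_num)
  have hUU₁ : U < U₁ := lt_of_le_of_lt (min_le_left _ _) (by linarith)
  have hU2 : 0 < U ^ 2 := by positivity
  have hi : ∀ χ : D4Irrep, χ ≠ D4Irrep.B1g →
      channelInf (squareDispersion 1 0) μ U D4Irrep.B1g + γ * U ^ 2 ≤ channelInf (squareDispersion 1 0) μ U χ := by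
    have h := hU U ⟨hU0, hUU₁⟩
    dsimp only at h
    exact h.1
  -- the frame at the level `μ`
  have hfin : IsFiniteMeasure (fermiCurveMeasure (squareDispersion 1 0) μ) :=
    stub_klFiniteMeasure stub_klGradient stub_klHausdorffFinite μ hμ
  have hinv := stub_klD4Invariant stub_klGradient μ hμ
  have hhom : ∀ {χ : D4Irrep}, χ ≠ D4Irrep.A1g →
      channelInf (squareDispersion 1 0) μ U χ = U ^ 2 * channelInf (squareDispersion 1 0) μ 1 χ := fun {χ} hχ =>
    kl_rl_channelInf_sq_of_meanZero hμ.1 hμ.2 U χ (fun ψ hψ => (stub_klMeanZero _ _ hfin hinv χ ψ hχ hψ).2)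
  have hB := hhom (show D4Irrep.B1g ≠ D4Irrep.A1g by decide)
  refine ⟨a, haI, γ, hγ, fun χ hχ hχA => ?_, fun φ hφ hmean => ?_⟩
  · have h := hi χ hχ
    rw [hB, hhom hχA] at h
    have h' : U ^ 2 * (channelInf (squareDispersion 1 0) μ 1 D4Irrep.B1g + γ) ≤
        U ^ 2 * channelInf (squareDispersion 1 0) μ 1 χ := by nlinarith
    exact le_of_mul_le_mul_left h' hU2
  · have h := hi D4Irrep.A1g (by decide)
    rw [hB] at h
    have hle : channelInf (squareDispersion 1 0) μ U D4Irrep.A1g ≤ pairingForm (squareDispersion 1 0) μ U φ :=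
      csInf_le (kl_rl_bddBelow hμ.1 hμ.2 U D4Irrep.A1g) ⟨φ, hφ, rfl⟩
    rw [kl_rl_pairingForm_sq hμ.1 hμ.2 U hφ.1 hmean] at hle
    have h' : U ^ 2 * (channelInf (squareDispersion 1 0) μ 1 D4Irrep.B1g + γ) ≤
        U ^ 2 * pairingForm (squareDispersion 1 0) μ 1 φ := by nlinarith
    exact le_of_mul_le_mul_left h' hU2

end Summit.HubbardSuperconductivity.HubbardSuperconductivity.Theorems.CwThesis

end
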